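import Summits.HubbardSuperconductivity.HubbardSuperconductivity.Theorems.AnisotropyChordTransferFibre3B1Objects

/-!
# Route `AnisotropyChord` / H0 rotor rung, LEVEL 2 family B1: the GENERIC L-UNIFORM BRACKET of near-dominated lattice sums

Memo ROTOR-THEORY-21 §311(b), family B1 (theory seat `hubbard-h0-rotor-theory-1` g21; LEVEL2-SPEC §3).  PartN35 typed and
`…Fibre3S2Bracket` (p3 g2) proved the template `S2UniformBracket` (`n = 2`, one factor); the memo's instruction for every
other family-B1 input (`S_p`, `Σ_k g(k)^a g(k+K₁)^b`, `t(q)`, `Π̂`-type triangles, …) is «the same brackets applied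
factorwise (shifted factors bracketed at m + m_ext)».  THIS FILE does that once, for ALL finite products of shifted
propagator powers (objects in `…Fibre3B1Objects`): with `θ = 2π/L ≤ θ₀`, `θ₀·K ≤ π/2` (e.g. `θ₀ = 2π/L₀`, `K = L₀/4` for
every `L ≥ L₀`), shifts `|s_i|∞ ≤ S`, exponents `a_i ≥ 1`, `n = Σ a_i ≥ 2`, `2 + 2S ≤ K`, `0 ≤ ν < 4/π²`:
  ★ `b1Bracket`:  `loSum ν K S s a ≤ θ^{2n} · torSum L (νθ²) s a ≤ hiSum ν θ₀ K S s a + tailConst ν (K − 2S) n`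
(both bounds L-INDEPENDENT finite expressions).  Halves: `b1_lower`, `b1_upper`; pointwise step `prod_Xf_le`; summed tail
`tail_majorant_sum_le`.
Proof: LOWER — `idx` injects into the torus (`2(K+S) < L`) and `2(1 − cos u) ≤ u²` per factor (`Xf_lower`);
UPPER — a momentum whose every shifted lift lies in the window is bounded factorwise by the Taylor bracket
`u² − u⁴/12 ≤ 2(1 − cos u)`, `θ ≤ θ₀` (`Xf_window`); a momentum with a vanishing factor contributes `0` (`a_i ≥ 1`); any other
momentum has EVERY shifted factor in the tail `|·|∞ > K − 2S` of its own centred representative (`rep_add_mem_tail`), so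
weighted AM–GM `Π X_i^{a_i} ≤ Σ (a_i/n) X_iⁿ` (`B1.prod_pow_le_sum_pow`), Jordan (`Xf_pow_tail`), the reindexing
`k ↦ k + s_i` (`Equiv.addRight`) and p3's telescoped shell bound `tail_sum_le_telescope` (`…Fibre3S2Tail`) give `tailConst`
(with the extra gain `((K'+1)² − νπ²/4)^{−(n−2)}` for `n > 2`).
Prover seat `hubbard-h0-rotor-p2` g4; helper for piece A = stmt-HubbardSuperconductivity-23918 of rung 19089
(`--supports`, helper class).  Nothing here proves superconductivity in the Hubbard model; helper lemmas of ONE conditional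
reduction (the GM₃ ∀L certificate, Level-2 rows); the rotor TARGET as originally worded stays FALSE (g15 verdict).
Mathlib + the tree only; no sorry.
-/

set_option linter.dupNamespace false
set_option autoImplicit false

noncomputable section

open scoped BigOperators

namespace Summit.HubbardSuperconductivity.HubbardSuperconductivity.Theorems.AnisotropyChord.Transfer.Fibre3.B1

variable (L : ℕ) [NeZero L]

variable {ι : Type*} [Fintype ι]

/-! ## The bracket -/

/-- **LOWER half of the B1 bracket**: `loSum ≤ θ^{2n}·torSum`. -/
theorem b1_lower (K S : ℕ) (s : ι → ℤ × ℤ) (a : ι → ℕ) (n : ℕ) (hn : ∑ i, a i = n)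
    (hK : 2 + 2 * S ≤ K) (h4K : 4 * K ≤ L) (ν : ℝ) (hν : ν < 4 / Real.pi ^ 2) :
    loSum ν K S s a ≤ (2 * Real.pi / L) ^ (2 * n) * torSum L (ν * (2 * Real.pi / L) ^ 2) s a := by
  classical
  rw [scaled_torSum_eq L ν s a n hn]
  have h2KS : 2 * (K + S) < L := by omega
  have hinj : Set.InjOn (toTor L) (idx K S s : Set (ℤ × ℤ)) := by
    intro p hp q hq hpq
    rw [Finset.mem_coe, mem_idx_iff, mem_box_iff] at hp hq
    exact intCast_eq_of_mem_box L (K + S) h2KS p q hp.1 hq.1 hpq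
  have hterm : ∀ p ∈ idx K S s,
      ∏ i, (1 / (nsq (p + s i) - ν)) ^ a i ≤ ∏ i, Xf L ν (s i) (toTor L p) ^ a i := by
    intro p hp
    rw [mem_idx_iff] at hp
    apply Finset.prod_le_prod
    · intro i _
      exact pow_nonneg (lo_nonneg ν hν _ ((mem_zWindow_iff K _).1 (hp.2 i)).1) _
    · intro i _
      exact pow_le_pow_left₀ (lo_nonneg ν hν _ ((mem_zWindow_iff K _).1 (hp.2 i)).1)
        (Xf_lower L ν hν K h4K (s i) (toTor L p) (p + s i) (hp.2 i) (by rw [toTor_add])) _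
  have hT0 : ∀ k : Tor L, 0 ≤ ∏ i, Xf L ν (s i) k ^ a i :=
    fun k => Finset.prod_nonneg fun i _ => pow_nonneg (Xf_nonneg L ν hν _ _) _
  calc loSum ν K S s a = ∑ p ∈ idx K S s, ∏ i, (1 / (nsq (p + s i) - ν)) ^ a i := rfl
    _ ≤ ∑ p ∈ idx K S s, ∏ i, Xf L ν (s i) (toTor L p) ^ a i := Finset.sum_le_sum hterm
    _ = ∑ k ∈ (idx K S s).image (toTor L), ∏ i, Xf L ν (s i) k ^ a i := by
        rw [Finset.sum_image hinj]
    _ ≤ ∑ k : Tor L, ∏ i, Xf L ν (s i) k ^ a i :=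
        Finset.sum_le_sum_of_subset_of_nonneg (Finset.subset_univ _) (fun k _ _ => hT0 k)

/-- pointwise domination of a product of scaled factors by the window majorant plus the averaged tail majorant. -/
theorem prod_Xf_le (θ0 : ℝ) (K S : ℕ) (s : ι → ℤ × ℤ) (a : ι → ℕ) (n : ℕ)
    (ha : ∀ i, 1 ≤ a i) (hn : ∑ i, a i = n) (h2 : 2 ≤ n)
    (hS : ∀ i, (s i).1.natAbs ≤ S ∧ (s i).2.natAbs ≤ S) (hK : 2 + 2 * S ≤ K)
    (hθ0 : 2 * Real.pi / L ≤ θ0) (hθ0K : θ0 * K ≤ Real.pi / 2)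
    (ν : ℝ) (hν : ν < 4 / Real.pi ^ 2) (k : Tor L) :
    ∏ i, Xf L ν (s i) k ^ a i
      ≤ (if rep L k ∈ idx K S s then ∏ i, (1 / (winE θ0 (rep L k + s i) - ν)) ^ a i else 0)
        + ∑ j, ((a j : ℝ) / n) *
          (if rep L (k + toTor L (s j)) ∈ zWindow (L / 2) \ zWindow (K - 2 * S) then
            (Real.pi ^ 2 / 4 / ((((K - 2 * S : ℕ) : ℝ) + 1) ^ 2 - ν * Real.pi ^ 2 / 4)) ^ (n - 2)
              * (Real.pi ^ 2 / 4 / (nsq (rep L (k + toTor L (s j))) - ν * Real.pi ^ 2 / 4)) ^ 2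
          else 0) := by
  classical
  have h4K := four_mul_le_of_scales L θ0 K hθ0 hθ0K
  have hn0 : n ≠ 0 := by omega
  have hpi3 := Real.pi_gt_three
  have hc1 : ν * Real.pi ^ 2 / 4 < 1 := by
    rw [div_lt_one (by norm_num)]
    have := (lt_div_iff₀ (by positivity)).mp hν
    linarith
  have hK'R : (2 : ℝ) ≤ ((K - 2 * S : ℕ) : ℝ) := by exact_mod_cast (show 2 ≤ K - 2 * S by omega)
  -- a distinguished index
  have hne : (Finset.univ : Finset ι).Nonempty := by
    by_contra h
    rw [Finset.not_nonempty_iff_eq_empty] at h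
    rw [h, Finset.sum_empty] at hn
    omega
  obtain ⟨i0, -⟩ := hne
  -- nonnegativity of both majorants
  have hW0 : 0 ≤ (if rep L k ∈ idx K S s then ∏ i, (1 / (winE θ0 (rep L k + s i) - ν)) ^ a i else 0) := by
    split_ifs with hp
    · rw [mem_idx_iff] at hp
      exact Finset.prod_nonneg fun i _ =>
        pow_nonneg (div_nonneg zero_le_one (hi_den_pos L ν hν θ0 K hθ0 hθ0K _ (hp.2 i)).le) _
    · exact le_rfl
  have hG0 : ∀ j, 0 ≤ (if rep L (k + toTor L (s j)) ∈ zWindow (L / 2) \ zWindow (K - 2 * S) then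
            (Real.pi ^ 2 / 4 / ((((K - 2 * S : ℕ) : ℝ) + 1) ^ 2 - ν * Real.pi ^ 2 / 4)) ^ (n - 2)
              * (Real.pi ^ 2 / 4 / (nsq (rep L (k + toTor L (s j))) - ν * Real.pi ^ 2 / 4)) ^ 2
          else 0) := by
    intro j
    split_ifs
    · have hD1 : 0 < (((K - 2 * S : ℕ) : ℝ) + 1) ^ 2 - ν * Real.pi ^ 2 / 4 := by nlinarith
      positivity
    · exact le_rfl
  have hsum0 := Finset.sum_nonneg fun j (_ : j ∈ (Finset.univ : Finset ι)) =>
    mul_nonneg (by positivity : (0 : ℝ) ≤ (a j : ℝ) / n) (hG0 j)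
  by_cases hA : ∀ i, rep L k + s i ∈ zWindow K
  · -- WINDOW POINT
    have hidx : rep L k ∈ idx K S s := by
      rw [mem_idx_iff, mem_box_iff]
      refine ⟨?_, hA⟩
      have h0 := hA i0
      rw [mem_zWindow_iff] at h0
      obtain ⟨-, ⟨h1a, h1b⟩, ⟨h2a, h2b⟩⟩ := h0
      have hs1 := (hS i0).1
      have hs2 := (hS i0).2
      simp only [Prod.fst_add, Prod.snd_add] at h1a h1b h2a h2b
      refine ⟨⟨?_, ?_⟩, ⟨?_, ?_⟩⟩ <;> push_cast <;> omega
    rw [if_pos hidx]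
    have hle : ∏ i, Xf L ν (s i) k ^ a i ≤ ∏ i, (1 / (winE θ0 (rep L k + s i) - ν)) ^ a i := by
      apply Finset.prod_le_prod
      · intro i _
        exact pow_nonneg (Xf_nonneg L ν hν _ _) _
      · intro i _
        exact pow_le_pow_left₀ (Xf_nonneg L ν hν _ _)
          (Xf_window L ν hν θ0 K hθ0 hθ0K (s i) k (rep L k + s i) (hA i)
            (by unfold rep; exact toTor_rep_add L k (s i))) _
    linarith
  · push Not at hA
    obtain ⟨i1, hi1⟩ := hA
    by_cases hZ : ∃ j, k + toTor L (s j) = 0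
    · -- a factor vanishes
      obtain ⟨j, hj⟩ := hZ
      have hT0 : ∏ i, Xf L ν (s i) k ^ a i = 0 := by
        apply Finset.prod_eq_zero (Finset.mem_univ j)
        unfold Xf gres
        rw [hj, if_pos rfl, mul_zero, zero_pow (by have := ha j; omega)]
      rw [hT0]
      linarith
    · -- TAIL POINT
      push Not at hZ
      have hne1 : rep L k + s i1 ≠ (0, 0) := by
        intro h
        apply hZ i1
        have e := toTor_rep_add L k (s i1)
        unfold rep at h
        rw [h] at e
        rw [e]
        unfold toTor
        simp
      have hXn : ∀ j, Xf L ν (s j) k ^ n ≤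
          (if rep L (k + toTor L (s j)) ∈ zWindow (L / 2) \ zWindow (K - 2 * S) then
            (Real.pi ^ 2 / 4 / ((((K - 2 * S : ℕ) : ℝ) + 1) ^ 2 - ν * Real.pi ^ 2 / 4)) ^ (n - 2)
              * (Real.pi ^ 2 / 4 / (nsq (rep L (k + toTor L (s j))) - ν * Real.pi ^ 2 / 4)) ^ 2
          else 0) := by
        intro j
        obtain ⟨hmem, hsq⟩ := rep_add_mem_tail L K S hK h4K k (s j) (s i1) (hS j) (hS i1) hne1 hi1 (hZ j)
        rw [if_pos hmem]
        exact Xf_pow_tail L ν hν (s j) k (hZ j) n (K - 2 * S) h2 hsq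
      have hamgm := prod_pow_le_sum_pow Finset.univ (fun i => Xf L ν (s i) k)
        (fun i _ => Xf_nonneg L ν hν _ _) a n hn hn0
      have step : ∑ i, ((a i : ℝ) / n) * Xf L ν (s i) k ^ n
          ≤ ∑ j, ((a j : ℝ) / n) *
            (if rep L (k + toTor L (s j)) ∈ zWindow (L / 2) \ zWindow (K - 2 * S) then
              (Real.pi ^ 2 / 4 / ((((K - 2 * S : ℕ) : ℝ) + 1) ^ 2 - ν * Real.pi ^ 2 / 4)) ^ (n - 2)
                * (Real.pi ^ 2 / 4 / (nsq (rep L (k + toTor L (s j))) - ν * Real.pi ^ 2 / 4)) ^ 2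
            else 0) :=
        Finset.sum_le_sum fun j _ => mul_le_mul_of_nonneg_left (hXn j) (by positivity)
      linarith [hamgm, step]

/-- the summed one-propagator tail majorant: reindexed by the centred representative and bounded by the telescoped
shell sum of `…Fibre3S2Tail`. -/
theorem tail_majorant_sum_le (ν : ℝ) (hν0 : 0 ≤ ν) (hν : ν < 4 / Real.pi ^ 2) (K' n : ℕ) (hK'2 : 2 ≤ K')
    (hK'N : K' ≤ L / 2) (h2 : 2 ≤ n) :
    ∑ k : Tor L, (if rep L k ∈ zWindow (L / 2) \ zWindow K' then
        (Real.pi ^ 2 / 4 / (((K' : ℝ) + 1) ^ 2 - ν * Real.pi ^ 2 / 4)) ^ (n - 2)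
          * (Real.pi ^ 2 / 4 / (nsq (rep L k) - ν * Real.pi ^ 2 / 4)) ^ 2 else 0)
      ≤ tailConst ν K' n := by
  classical
  have hpi := Real.pi_pos
  have hpi3 := Real.pi_gt_three
  set c : ℝ := ν * Real.pi ^ 2 / 4 with hc
  have hc0 : 0 ≤ c := by positivity
  have hc1 : c < 1 := by
    rw [hc, div_lt_one (by norm_num)]
    have := (lt_div_iff₀ (by positivity)).mp hν
    linarith
  have hK'R : (2 : ℝ) ≤ K' := by exact_mod_cast hK'2
  have hN2 : (2 : ℝ) ≤ ((L / 2 : ℕ) : ℝ) := by exact_mod_cast hK'2.trans hK'N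
  set D1 : ℝ := ((K' : ℝ) + 1) ^ 2 - c with hD1
  set D2 : ℝ := (K' : ℝ) ^ 2 - c with hD2
  have hD1pos : 0 < D1 := by rw [hD1]; nlinarith
  have hD2pos : 0 < D2 := by rw [hD2]; nlinarith
  set Bc : ℝ := Real.pi ^ 2 / 4 / D1 with hBc
  have hrep_inj : Function.Injective (rep L) := rep_injective L
  set F : ℤ × ℤ → ℝ := fun q => if q ∈ zWindow (L / 2) \ zWindow K' then
      Bc ^ (n - 2) * (Real.pi ^ 2 / 4 / (nsq q - c)) ^ 2 else 0 with hF
  have step1 : ∑ k : Tor L, F (rep L k) ≤ ∑ q ∈ zWindow (L / 2) \ zWindow K',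
      Bc ^ (n - 2) * (Real.pi ^ 2 / 4 / (nsq q - c)) ^ 2 := by
    rw [← Finset.sum_image (fun x _ y _ h => hrep_inj h)]
    rw [hF, ← Finset.sum_filter]
    apply Finset.sum_le_sum_of_subset_of_nonneg
    · intro q hq
      exact (Finset.mem_filter.mp hq).2
    · intro q _ _
      positivity
  have step2 : ∑ q ∈ zWindow (L / 2) \ zWindow K', Bc ^ (n - 2) * (Real.pi ^ 2 / 4 / (nsq q - c)) ^ 2
      = Bc ^ (n - 2) * ((Real.pi ^ 2 / 4) ^ 2
          * ∑ q ∈ zWindow (L / 2) \ zWindow K', 1 / ((((q.1 : ℝ)) ^ 2 + ((q.2 : ℝ)) ^ 2) - c) ^ 2) := by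
    rw [Finset.mul_sum, Finset.mul_sum]
    have e : ∀ D : ℝ, (Real.pi ^ 2 / 4 / D) ^ 2 = (Real.pi ^ 2 / 4) ^ 2 * (1 / D ^ 2) := fun D => by
      rw [div_pow, div_eq_mul_one_div]
    refine Finset.sum_congr rfl fun q _ => ?_
    unfold nsq
    rw [e]
  have step3 := tail_sum_le_telescope K' hK'2 c hc0 hc1 (L / 2) hK'N
  have step4 : Real.pi * (1 / ((K' : ℝ) ^ 2 - c) - 1 / (((L / 2 : ℕ) : ℝ) ^ 2 - c)) ≤ Real.pi / D2 := by
    have h1 : 0 ≤ 1 / ((((L / 2 : ℕ)) : ℝ) ^ 2 - c) := div_nonneg zero_le_one (by nlinarith)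
    have h2 : Real.pi * (1 / ((K' : ℝ) ^ 2 - c) - 1 / (((L / 2 : ℕ) : ℝ) ^ 2 - c))
        ≤ Real.pi * (1 / ((K' : ℝ) ^ 2 - c)) := mul_le_mul_of_nonneg_left (by linarith) hpi.le
    rw [mul_one_div] at h2
    exact h2
  have hTailEq : Bc ^ (n - 2) * ((Real.pi ^ 2 / 4) ^ 2 * (Real.pi / D2)) = tailConst ν K' n := by
    unfold tailConst
    rw [hBc, hD1, hD2, hc, div_pow]
    obtain ⟨m, rfl⟩ : ∃ m, n = m + 2 := ⟨n - 2, by omega⟩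
    rw [Nat.add_sub_cancel, pow_add]
    have hD1ne : ((K' : ℝ) + 1) ^ 2 - ν * Real.pi ^ 2 / 4 ≠ 0 := by rw [← hc]; exact hD1pos.ne'
    have hD2ne : (K' : ℝ) ^ 2 - ν * Real.pi ^ 2 / 4 ≠ 0 := by rw [← hc]; exact hD2pos.ne'
    field_simp
  have e0 : (∑ k : Tor L, (if rep L k ∈ zWindow (L / 2) \ zWindow K' then
        (Real.pi ^ 2 / 4 / (((K' : ℝ) + 1) ^ 2 - ν * Real.pi ^ 2 / 4)) ^ (n - 2)
          * (Real.pi ^ 2 / 4 / (nsq (rep L k) - ν * Real.pi ^ 2 / 4)) ^ 2 else 0))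
      = ∑ k : Tor L, F (rep L k) := by
    refine Finset.sum_congr rfl fun k _ => ?_
    rw [hF]
  rw [e0, ← hTailEq]
  calc ∑ k : Tor L, F (rep L k) ≤ _ := step1
    _ = _ := step2
    _ ≤ Bc ^ (n - 2) * ((Real.pi ^ 2 / 4) ^ 2 * (Real.pi / D2)) := by
        gcongr
        exact step3.trans step4

/-- **UPPER half of the B1 bracket**: `θ^{2n}·torSum ≤ hiSum + tailConst`. -/
theorem b1_upper (θ0 : ℝ) (K S : ℕ) (s : ι → ℤ × ℤ) (a : ι → ℕ) (n : ℕ)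
    (ha : ∀ i, 1 ≤ a i) (hn : ∑ i, a i = n) (h2 : 2 ≤ n)
    (hS : ∀ i, (s i).1.natAbs ≤ S ∧ (s i).2.natAbs ≤ S) (hK : 2 + 2 * S ≤ K)
    (hθ0 : 2 * Real.pi / L ≤ θ0) (hθ0K : θ0 * K ≤ Real.pi / 2)
    (ν : ℝ) (hν0 : 0 ≤ ν) (hν : ν < 4 / Real.pi ^ 2) :
    (2 * Real.pi / L) ^ (2 * n) * torSum L (ν * (2 * Real.pi / L) ^ 2) s a
      ≤ hiSum ν θ0 K S s a + tailConst ν (K - 2 * S) n := by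
  classical
  have h4K := four_mul_le_of_scales L θ0 K hθ0 hθ0K
  have hn0 : n ≠ 0 := by omega
  have hK'2 : 2 ≤ K - 2 * S := by omega
  have hK'N : K - 2 * S ≤ L / 2 := by omega
  rw [scaled_torSum_eq L ν s a n hn]
  -- names for the two majorants
  set Aw : ℤ × ℤ → ℝ := fun p =>
    if p ∈ idx K S s then ∏ i, (1 / (winE θ0 (p + s i) - ν)) ^ a i else 0 with hAw
  set G : Tor L → ℝ := fun k' =>
    if rep L k' ∈ zWindow (L / 2) \ zWindow (K - 2 * S) then
      (Real.pi ^ 2 / 4 / ((((K - 2 * S : ℕ) : ℝ) + 1) ^ 2 - ν * Real.pi ^ 2 / 4)) ^ (n - 2)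
        * (Real.pi ^ 2 / 4 / (nsq (rep L k') - ν * Real.pi ^ 2 / 4)) ^ 2
    else 0 with hG
  have hdom : ∀ k : Tor L, ∏ i, Xf L ν (s i) k ^ a i ≤ Aw (rep L k) + ∑ j, ((a j : ℝ) / n) * G (k + toTor L (s j)) := by
    intro k
    have h := prod_Xf_le L θ0 K S s a n ha hn h2 hS hK hθ0 hθ0K ν hν k
    rw [hAw, hG]
    exact h
  -- the window majorant sums to at most `hiSum`
  have hrep_inj : Function.Injective (rep L) := rep_injective L
  have hsumA : ∑ k : Tor L, Aw (rep L k) ≤ hiSum ν θ0 K S s a := by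
    unfold hiSum
    rw [← Finset.sum_image (fun x _ y _ h => hrep_inj h)]
    rw [hAw, ← Finset.sum_filter]
    apply Finset.sum_le_sum_of_subset_of_nonneg
    · intro p hp
      exact (Finset.mem_filter.mp hp).2
    · intro p hp _
      rw [mem_idx_iff] at hp
      exact Finset.prod_nonneg fun i _ =>
        pow_nonneg (div_nonneg zero_le_one (hi_den_pos L ν hν θ0 K hθ0 hθ0K _ (hp.2 i)).le) _
  -- the tail majorant: reindex each `j`, then the one-propagator bound
  have hreindex : ∀ j, ∑ k : Tor L, G (k + toTor L (s j)) = ∑ k : Tor L, G k :=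
    fun j => Equiv.sum_comp (Equiv.addRight (toTor L (s j))) G
  have hsumG : ∑ k : Tor L, G k ≤ tailConst ν (K - 2 * S) n := by
    rw [hG]
    exact tail_majorant_sum_le L ν hν0 hν (K - 2 * S) n hK'2 hK'N h2
  have hG0 : 0 ≤ ∑ k : Tor L, G k := by
    apply Finset.sum_nonneg
    intro k _
    rw [hG]
    dsimp only
    split_ifs
    · have hpi3 := Real.pi_gt_three
      have hc1 : ν * Real.pi ^ 2 / 4 < 1 := by
        rw [div_lt_one (by norm_num)]
        have := (lt_div_iff₀ (by positivity)).mp hν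
        linarith
      have hK'R : (2 : ℝ) ≤ ((K - 2 * S : ℕ) : ℝ) := by exact_mod_cast hK'2
      have hD1 : 0 < (((K - 2 * S : ℕ) : ℝ) + 1) ^ 2 - ν * Real.pi ^ 2 / 4 := by nlinarith
      positivity
    · exact le_rfl
  have hw1 : ∑ j, ((a j : ℝ) / n) = 1 := by
    rw [← Finset.sum_div, ← Nat.cast_sum, hn, div_self (by exact_mod_cast hn0)]
  calc ∑ k : Tor L, ∏ i, Xf L ν (s i) k ^ a i
      ≤ ∑ k : Tor L, (Aw (rep L k) + ∑ j, ((a j : ℝ) / n) * G (k + toTor L (s j))) :=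
        Finset.sum_le_sum fun k _ => hdom k
    _ = ∑ k : Tor L, Aw (rep L k) + ∑ j, ((a j : ℝ) / n) * ∑ k : Tor L, G (k + toTor L (s j)) := by
        rw [Finset.sum_add_distrib, Finset.sum_comm]
        congr 1
        refine Finset.sum_congr rfl fun j _ => ?_
        rw [Finset.mul_sum]
    _ = ∑ k : Tor L, Aw (rep L k) + (∑ j, ((a j : ℝ) / n)) * ∑ k : Tor L, G k := by
        congr 1
        rw [Finset.sum_mul]
        refine Finset.sum_congr rfl fun j _ => ?_
        rw [hreindex j]
    _ ≤ hiSum ν θ0 K S s a + 1 * tailConst ν (K - 2 * S) n := by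
        rw [hw1]
        gcongr
    _ = hiSum ν θ0 K S s a + tailConst ν (K - 2 * S) n := by rw [one_mul]

/-- **THE GENERIC L-UNIFORM B1 BRACKET** (memo 21 §311(b), family B1, «the same brackets applied factorwise»).
For `θ = 2π/L ≤ θ₀`, `θ₀K ≤ π/2`, shifts `|s_i|∞ ≤ S`, exponents `a_i ≥ 1` with `Σ a_i = n ≥ 2`, `2 + 2S ≤ K`,
`0 ≤ ν < 4/π²`:  `loSum ≤ θ^{2n}·torSum L (νθ²) ≤ hiSum + tailConst ν (K − 2S) n` — both bounds L-independent. -/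
theorem b1Bracket (θ0 : ℝ) (K S : ℕ) (s : ι → ℤ × ℤ) (a : ι → ℕ) (n : ℕ)
    (ha : ∀ i, 1 ≤ a i) (hn : ∑ i, a i = n) (h2 : 2 ≤ n)
    (hS : ∀ i, (s i).1.natAbs ≤ S ∧ (s i).2.natAbs ≤ S) (hK : 2 + 2 * S ≤ K)
    (hθ0 : 2 * Real.pi / L ≤ θ0) (hθ0K : θ0 * K ≤ Real.pi / 2)
    (ν : ℝ) (hν0 : 0 ≤ ν) (hν : ν < 4 / Real.pi ^ 2) :
    loSum ν K S s a ≤ (2 * Real.pi / L) ^ (2 * n) * torSum L (ν * (2 * Real.pi / L) ^ 2) s a ∧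
      (2 * Real.pi / L) ^ (2 * n) * torSum L (ν * (2 * Real.pi / L) ^ 2) s a
        ≤ hiSum ν θ0 K S s a + tailConst ν (K - 2 * S) n :=
  ⟨b1_lower L K S s a n hn hK (four_mul_le_of_scales L θ0 K hθ0 hθ0K) ν hν,
    b1_upper L θ0 K S s a n ha hn h2 hS hK hθ0 hθ0K ν hν0 hν⟩

end Summit.HubbardSuperconductivity.HubbardSuperconductivity.Theorems.AnisotropyChord.Transfer.Fibre3.B1

end
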